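import Summits.Parity.GeneralizedHardyLittlewood.Theorems.LeeYangFibresRelativeDimOneSplitCosetMean
import HarnessLib

/-!
# Coset singular means II: sums over box-cosets, progressions, degenerate shifts
(crux stmt-Parity-14113 `LeeYangFibres.RelativeDimOne`, line gallagher-backwards-split, stub
`stub_cosetSingularMean`, infrastructure file 2 of 3)

Combinatorics of the BOX-COSETS `C = {b ∈ ∏_l [u_l, u_l + X_l] : b ≡ c (q)}` over which
`CosetSingularMean` averages the singular series `𝔖(sys a b)`:

* `sum_coset_eq_of_periodic`: for coprime `P, q ≥ 1`, a `P`-periodic `g : ℤ^t → ℝ` and a block box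
  `B = ∏_l [u_l, u_l + m_l P q)`, `∑_{b ∈ B, b ≡ c (q)} g(b) = (∏_l m_l) ∑_{x ∈ [0,P)^t} g(u + x)`
  (translation to `ℕ^t`, Gallagher's block summation `sum_piFinset_Ico_of_periodic'`, and the Chinese
  remainder theorem `Gallagher.sum_filter_modVec_eq` on one period);
* `sum_coset_prod_localFactor` (registered auxiliary theorem `sum_coset_prod_localFactor_eq`): with
  `g = ∏_{p ∈ S} β_p(sys a ·)` for primes `p ∤ q` this is EXACTLY `(∏ m_l) P^t` by the exact local
  averages of file I (`sum_prod_localFactor_sys`); `card_coset`: the coset has `(∏ m_l) P^t` points in `B`;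
* `card_filter_Ico_modEq`, `div_le_card_filter_Icc_modEq`: a progression `{x ∈ [u, u+X] : x ≡ c (q)}`
  has `≥ ⌊(X+1)/q⌋` terms;
* `card_filter_degenerate_mul_le`: in a product set `∏ T_l` the shifts `b` with `sys a b` degenerate are
  few, `#{degenerate} · min_l #T_l ≤ t² ∏_l #T_l` (each lies on a hyperplane `a_i b_j = a_j b_i`);
* `coset_block_subset`, `subset_coset_block`: the box-coset is sandwiched between the cosets of two block
  boxes (sides `m_l P q ≤ X_l + 1 ≤ (m_l + 1) P q`).

References: P. X. Gallagher, Mathematika 23 (1976), §2 [Gallagher1976]; D. A. Goldston, A. I. Suriajaya,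
"The prime number theorem and pair correlation of zeros … singular series average in progressions" (2021),
Lemma 1 (the pair case along a progression).
-/

noncomputable section

open scoped BigOperators Classical
open Finset Literature.NumberTheory.Sieve

namespace Summit.Parity.GeneralizedHardyLittlewood.Cruxes.RelativeDimOne.GallagherBackwardsSplit

namespace CosetMeanProof

variable {t : ℕ}

/-! ### Sums of periodic functions over box-cosets -/

/-- Translation of an integer box `∏_l [u_l, u_l + n_l)` onto the box `∏_l [0, n_l) ⊆ ℕ^t`. -/
theorem sum_piFinset_Ico_eq_sum_range (u : Fin t → ℤ) (n : Fin t → ℕ) (G : (Fin t → ℤ) → ℝ) :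
    ∑ b ∈ Fintype.piFinset (fun l => Ico (u l) (u l + (n l : ℤ))), G b =
      ∑ v ∈ Fintype.piFinset (fun l => range (n l)), G (fun l => u l + (v l : ℤ)) := by
  refine Finset.sum_nbij' (fun b l => (b l - u l).toNat) (fun v l => u l + (v l : ℤ)) ?_ ?_ ?_ ?_ ?_
  · intro b hb
    simp only [Fintype.mem_piFinset, mem_Ico, mem_range] at hb ⊢
    intro l
    have := hb l
    omega
  · intro v hv
    simp only [Fintype.mem_piFinset, mem_Ico, mem_range] at hv ⊢
    intro l
    have := hv l
    constructor <;> omega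
  · intro b hb
    simp only [Fintype.mem_piFinset, mem_Ico] at hb
    funext l
    have := hb l
    dsimp only
    omega
  · intro v _
    funext l
    dsimp only
    omega
  · intro b hb
    simp only [Fintype.mem_piFinset, mem_Ico] at hb
    dsimp only
    congr 1
    funext l
    have := hb l
    omega

/-- SUMS OVER BOX-COSETS. Let `q, P ≥ 1` be coprime, `g : ℤ^t → ℝ` `P`-periodic in every coordinate,
`c ∈ ℤ^t` a residue vector and `B = ∏_l [u_l, u_l + m_l P q)` an integer box whose sides are multiples
of `P q`. Then `∑_{b ∈ B, b ≡ c (q)} g(b) = (∏_l m_l) · ∑_{x ∈ [0,P)^t} g(u + x)`: translate to `ℕ^t`,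
sum the `Pq`-periodic function `1_{b ≡ c (q)} g` block by block (`sum_piFinset_Ico_of_periodic'`), and on
one period use the Chinese remainder theorem (`Gallagher.sum_filter_modVec_eq`). -/
theorem sum_coset_eq_of_periodic {q P : ℕ} (hq : 0 < q) (hP : 0 < P) (hcop : Nat.Coprime P q)
    (u c : Fin t → ℤ) (m : Fin t → ℕ) (g : (Fin t → ℤ) → ℝ)
    (hg : ∀ b b' : Fin t → ℤ, (∀ l, b l ≡ b' l [ZMOD P]) → g b = g b') :
    ∑ b ∈ (Fintype.piFinset fun l => Ico (u l) (u l + ((m l * (P * q) : ℕ) : ℤ))).filter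
        (fun b => ∀ l, b l ≡ c l [ZMOD q]), g b =
      (∏ l, (m l : ℝ)) *
        ∑ x ∈ Fintype.piFinset (fun _ : Fin t => range P), g (fun l => u l + (x l : ℤ)) := by
  have hq0 : (0 : ℤ) < q := by exact_mod_cast hq
  -- the residues of `c - u` modulo `q`
  set c' : Fin t → ℕ := fun l => ((c l - u l) % (q : ℤ)).toNat with hc'
  have hc'q : c' ∈ Fintype.piFinset fun _ : Fin t => range q := by
    refine Fintype.mem_piFinset.2 fun l => mem_range.2 ?_
    have h1 := Int.emod_nonneg (c l - u l) hq0.ne'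
    have h2 := Int.emod_lt_of_pos (c l - u l) hq0
    simp only [hc']
    omega
  -- the coset condition on `b = u + v` is a condition on `v mod q`
  have hcond : ∀ v : Fin t → ℕ,
      (∀ l, u l + (v l : ℤ) ≡ c l [ZMOD q]) ↔ Gallagher.modVec q v = c' := by
    intro v
    rw [funext_iff]
    refine forall_congr' fun l => ?_
    rw [Gallagher.modVec_apply]
    have e : (u l + (v l : ℤ) ≡ c l [ZMOD q]) ↔ ((v l : ℤ) ≡ c l - u l [ZMOD q]) := by
      rw [Int.modEq_iff_dvd, Int.modEq_iff_dvd, sub_sub]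
    rw [e, Int.ModEq, ← Int.natCast_emod]
    have h1 := Int.emod_nonneg (c l - u l) hq0.ne'
    simp only [hc']
    generalize (c l - u l) % (q : ℤ) = w at h1 ⊢
    omega
  -- `g(u + ·)` is `n`-periodic on `ℕ^t` for every multiple `n` of `P`
  have hgmod : ∀ n : ℕ, P ∣ n → ∀ v : Fin t → ℕ,
      g (fun l => u l + ((Gallagher.modVec n v l : ℕ) : ℤ)) = g (fun l => u l + (v l : ℤ)) := by
    intro n hn v
    refine hg _ _ fun l => Int.ModEq.add_left _ ?_
    rw [Gallagher.modVec_apply, Int.natCast_emod]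
    exact (Int.mod_modEq _ _).of_dvd (Int.natCast_dvd_natCast.2 hn)
  -- the `Pq`-periodic function `1_{u + v ≡ c (q)} g(u + v)` on `ℕ^t`
  set G' : (Fin t → ℕ) → ℝ := fun v =>
    if Gallagher.modVec q v = c' then g (fun l => u l + (v l : ℤ)) else 0 with hG'
  have hper : ∀ v, G' (Gallagher.modVec (P * q) v) = G' v := by
    intro v
    have h1 : Gallagher.modVec q (Gallagher.modVec (P * q) v) = Gallagher.modVec q v := by
      funext l
      simp only [Gallagher.modVec_apply]
      exact Nat.mod_mul_left_mod (v l) P q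
    simp only [hG', h1, hgmod (P * q) (dvd_mul_right P q) v]
  have hbox : (Fintype.piFinset fun l => range (m l * (P * q))) =
      Fintype.piFinset fun l => Ico 0 (0 + m l * (P * q)) := by
    congr 1
    funext l
    rw [zero_add, Finset.range_eq_Ico]
  -- translate, sum block by block, and use CRT on one period
  rw [Finset.sum_filter, sum_piFinset_Ico_eq_sum_range]
  dsimp only
  rw [← Finset.sum_filter, Finset.filter_congr (fun v _ => hcond v), Finset.sum_filter, hbox,
    sum_piFinset_Ico_of_periodic' (Nat.mul_pos hP hq) (fun _ => 0) m G' hper]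
  congr 1
  simp only [hG']
  rw [← Finset.sum_filter]
  exact Gallagher.sum_filter_modVec_eq hP hq hcop (fun w => g (fun l => u l + (w l : ℤ)))
    (hgmod P (dvd_refl P)) hc'q

/-- COSET SUMS OF THE `q`-COPRIME LOCAL PRODUCTS: for a finite set `S` of primes not dividing `q ≥ 1`, with
product `P`, and a box `B = ∏_l [u_l, u_l + m_l P q)`,
`∑_{b ∈ B, b ≡ c (q)} ∏_{p ∈ S} β_p(sys a b) = (∏_l m_l) P^t` EXACTLY (the residues `b mod p`, `p ∈ S`,
equidistribute along the coset, and `𝔼_b ∏_{p ∈ S} β_p(a, b) = 1`). -/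
theorem sum_coset_prod_localFactor {q : ℕ} (hq : 0 < q) (S : Finset ℕ) (hS : ∀ p ∈ S, p.Prime)
    (hSq : ∀ p ∈ S, ¬ p ∣ q) (a u c : Fin t → ℤ) (m : Fin t → ℕ) :
    ∑ b ∈ (Fintype.piFinset fun l => Ico (u l) (u l + ((m l * ((∏ p ∈ S, p) * q) : ℕ) : ℤ))).filter
        (fun b => ∀ l, b l ≡ c l [ZMOD q]), ∏ p ∈ S, localFactor (sys a b) p =
      (∏ l, (m l : ℝ)) * ((∏ p ∈ S, p : ℕ) : ℝ) ^ t := by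
  have hP : 0 < ∏ p ∈ S, p := Finset.prod_pos fun p hp => (hS p hp).pos
  have hcop : Nat.Coprime (∏ p ∈ S, p) q :=
    Nat.Coprime.prod_left fun p hp => (Nat.Prime.coprime_iff_not_dvd (hS p hp)).2 (hSq p hp)
  rw [sum_coset_eq_of_periodic hq hP hcop u c m (fun b => ∏ p ∈ S, localFactor (sys a b) p)
    (fun b b' h => Finset.prod_congr rfl fun p hp => localFactor_sys_congr a fun l =>
      (h l).of_dvd (Int.natCast_dvd_natCast.2 (Finset.dvd_prod_of_mem _ hp))),
    sum_prod_localFactor_sys' a u S hS]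

/-- THE NUMBER OF POINTS OF THE COSET in a box `∏_l [u_l, u_l + m_l P q)` (`P, q ≥ 1` coprime):
`(∏_l m_l) P^t`. -/
theorem card_coset {q P : ℕ} (hq : 0 < q) (hP : 0 < P) (hcop : Nat.Coprime P q) (u c : Fin t → ℤ)
    (m : Fin t → ℕ) :
    (#((Fintype.piFinset fun l => Ico (u l) (u l + ((m l * (P * q) : ℕ) : ℤ))).filter
        (fun b => ∀ l, b l ≡ c l [ZMOD q])) : ℝ) = (∏ l, (m l : ℝ)) * (P : ℝ) ^ t := by
  rw [Finset.card_eq_sum_ones, Nat.cast_sum]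
  simp only [Nat.cast_one]
  rw [sum_coset_eq_of_periodic hq hP hcop u c m (fun _ => (1 : ℝ)) (fun _ _ _ => rfl), Finset.sum_const,
    Fintype.card_piFinset_const, Finset.card_range, nsmul_eq_mul, mul_one, Nat.cast_pow]

/-! ### One coordinate: the progression `{x ∈ [u, u + X] : x ≡ c (q)}` -/

/-- A block of `q` consecutive integers contains exactly one element of each residue class mod `q`. -/
theorem card_filter_Ico_modEq_one {q : ℕ} (hq : 0 < q) (w c : ℤ) :
    #((Ico w (w + q)).filter fun x => x ≡ c [ZMOD q]) = 1 := by
  have hq0 : (0 : ℤ) < q := by exact_mod_cast hq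
  rw [Finset.card_eq_one]
  refine ⟨w + (c - w) % q, ?_⟩
  ext x
  simp only [mem_filter, mem_Ico, mem_singleton]
  have h1 := Int.emod_nonneg (c - w) hq0.ne'
  have h2 := Int.emod_lt_of_pos (c - w) hq0
  constructor
  · rintro ⟨⟨hx1, hx2⟩, hx⟩
    have e1 : (x - w) % q = x - w := Int.emod_eq_of_lt (by omega) (by omega)
    have e2 : (x - w) % q = (c - w) % q := hx.sub_right w
    omega
  · rintro rfl
    refine ⟨⟨by omega, by omega⟩, ?_⟩
    have : w + (c - w) % q ≡ w + (c - w) [ZMOD q] := (Int.mod_modEq _ _).add_left _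
    rwa [add_sub_cancel] at this

/-- `m` consecutive blocks of length `q` contain exactly `m` elements of each residue class mod `q`. -/
theorem card_filter_Ico_modEq {q : ℕ} (hq : 0 < q) (w c : ℤ) (m : ℕ) :
    #((Ico w (w + ((m * q : ℕ) : ℤ))).filter fun x => x ≡ c [ZMOD q]) = m := by
  induction m with
  | zero => simp
  | succ m ih =>
    have e : w + (((m + 1) * q : ℕ) : ℤ) = w + ((m * q : ℕ) : ℤ) + (q : ℤ) := by push_cast; ring
    rw [e, ← Finset.Ico_union_Ico_eq_Ico (le_add_of_nonneg_right (by positivity))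
        (le_add_of_nonneg_right (by positivity)), Finset.filter_union,
      Finset.card_union_of_disjoint (Finset.disjoint_filter_filter (Finset.Ico_disjoint_Ico_consecutive _ _ _)),
      ih, card_filter_Ico_modEq_one hq]

/-- The progression `{x ∈ [u, u + X] : x ≡ c (q)}` has at least `⌊(X+1)/q⌋` terms. -/
theorem div_le_card_filter_Icc_modEq {q : ℕ} (hq : 0 < q) (u c : ℤ) (X : ℕ) :
    (X + 1) / q ≤ #((Icc u (u + X)).filter fun x => x ≡ c [ZMOD q]) := by
  have h1 : (X + 1) / q * q ≤ X + 1 := Nat.div_mul_le_self _ _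
  calc (X + 1) / q = #((Ico u (u + (((X + 1) / q * q : ℕ) : ℤ))).filter fun x => x ≡ c [ZMOD q]) :=
        (card_filter_Ico_modEq hq u c _).symm
    _ ≤ _ := by
        refine Finset.card_le_card (Finset.filter_subset_filter _ fun x hx => ?_)
        rw [mem_Ico] at hx
        rw [mem_Icc]
        have h2 : (((X + 1) / q * q : ℕ) : ℤ) ≤ X + 1 := by exact_mod_cast h1
        generalize ((X + 1) / q * q) = M at h2 hx
        omega

/-! ### The box-coset as a product of progressions; degenerate shifts are few -/

/-- The box-coset `{b ∈ ∏_l [u_l, u_l + X_l] : b ≡ c (q)}` is the product of the progressions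
`{x ∈ [u_l, u_l + X_l] : x ≡ c_l (q)}`. -/
theorem filter_box_modEq_eq (q : ℕ) (u c : Fin t → ℤ) (X : Fin t → ℕ) :
    (box u X).filter (fun b => ∀ l, b l ≡ c l [ZMOD q]) =
      Fintype.piFinset fun l => (Icc (u l) (u l + X l)).filter fun x => x ≡ c l [ZMOD q] := by
  ext b
  simp only [box, mem_filter, Fintype.mem_piFinset]
  exact ⟨fun h l => ⟨h.1 l, h.2 l⟩, fun h => ⟨fun l => (h l).1, fun l => (h l).2⟩⟩

/-- ONE HYPERPLANE: in a product set `∏_l T_l ⊆ ℤ^t` the points with `a_i b_j = a_j b_i` (`i ≠ j`,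
`a_i ≠ 0`) number at most `∏_{l ≠ j} #T_l` — the coordinate `b_j` is determined by `b_i`. -/
theorem card_filter_hyperplane_mul_le (T : Fin t → Finset ℤ) {a : Fin t → ℤ} {i j : Fin t} (hij : i ≠ j)
    (hai : a i ≠ 0) :
    #((Fintype.piFinset T).filter fun b => a i * b j = a j * b i) * #(T j) ≤ ∏ l, #(T l) := by
  set T' : Fin t → Finset ℤ := Function.update T j {0} with hT'
  have hcard : #(Fintype.piFinset T') * #(T j) = ∏ l, #(T l) := by
    rw [Fintype.card_piFinset, ← Finset.mul_prod_erase univ (fun l => #(T' l)) (mem_univ j),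
      ← Finset.mul_prod_erase univ (fun l => #(T l)) (mem_univ j)]
    have h1 : #(T' j) = 1 := by simp [hT']
    have h2 : ∏ l ∈ univ.erase j, #(T' l) = ∏ l ∈ univ.erase j, #(T l) :=
      Finset.prod_congr rfl fun l hl => by rw [hT', Function.update_of_ne (ne_of_mem_erase hl)]
    rw [h1, h2, one_mul, mul_comm]
  rw [← hcard]
  refine Nat.mul_le_mul_right _ (Finset.card_le_card_of_injOn (fun b => Function.update b j 0) ?_ ?_)
  · intro b hb
    rw [Finset.mem_coe, mem_filter, Fintype.mem_piFinset] at hb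
    rw [Finset.mem_coe, Fintype.mem_piFinset]
    intro l
    dsimp only
    by_cases hl : l = j
    · rw [hl, Function.update_self, hT', Function.update_self]
      exact mem_singleton_self 0
    · rw [Function.update_of_ne hl, hT', Function.update_of_ne hl]
      exact hb.1 l
  · intro b hb b' hb' heq
    rw [Finset.mem_coe, mem_filter] at hb hb'
    dsimp only at heq
    funext l
    by_cases hl : l = j
    · rw [hl]
      have hi : b i = b' i := by
        have := congr_fun heq i
        rwa [Function.update_of_ne hij, Function.update_of_ne hij] at this
      refine mul_left_cancel₀ hai ?_
      rw [hb.2, hb'.2, hi]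
    · have := congr_fun heq l
      rwa [Function.update_of_ne hl, Function.update_of_ne hl] at this

/-- DEGENERATE SHIFTS ARE FEW: in a product set `∏_l T_l` with `#T_l ≥ n₀` for all `l`, the shifts `b`
with `sys a b` degenerate (all `a_i ≠ 0`) satisfy `#{b degenerate} · n₀ ≤ t² ∏_l #T_l`
(each lies on one of the `≤ t²` hyperplanes `a_i b_j = a_j b_i`, `exists_crossDisc_eq_zero`). -/
theorem card_filter_degenerate_mul_le (T : Fin t → Finset ℤ) {a : Fin t → ℤ} (ha : ∀ i, a i ≠ 0)
    {n₀ : ℕ} (hn : ∀ l, n₀ ≤ #(T l)) :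
    #((Fintype.piFinset T).filter fun b => ¬ IsNondegenerateSystem (sys a b)) * n₀ ≤
      t * t * ∏ l, #(T l) := by
  set pairs := (univ : Finset (Fin t × Fin t)).filter fun ij => ij.1 ≠ ij.2 with hpairs
  set H : Fin t × Fin t → Finset (Fin t → ℤ) := fun ij =>
    (Fintype.piFinset T).filter fun b => a ij.1 * b ij.2 = a ij.2 * b ij.1 with hH
  have hcover : ((Fintype.piFinset T).filter fun b => ¬ IsNondegenerateSystem (sys a b)) ⊆
      pairs.biUnion H := by
    intro b hb
    rw [mem_filter] at hb
    obtain ⟨i, j, hij, hb2⟩ := exists_crossDisc_eq_zero ha hb.2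
    exact mem_biUnion.2 ⟨(i, j), by simp [hpairs, hij], mem_filter.2 ⟨hb.1, hb2⟩⟩
  have heach : ∀ ij ∈ pairs, #(H ij) * n₀ ≤ ∏ l, #(T l) := by
    rintro ⟨i, j⟩ hij
    simp only [hpairs, mem_filter, mem_univ, true_and] at hij
    calc #(H (i, j)) * n₀ ≤ #(H (i, j)) * #(T j) := Nat.mul_le_mul_left _ (hn j)
      _ ≤ ∏ l, #(T l) := card_filter_hyperplane_mul_le T hij (ha i)
  have hpc : #pairs ≤ t * t :=
    calc #pairs ≤ #(univ : Finset (Fin t × Fin t)) := card_filter_le _ _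
      _ = t * t := by simp
  calc #((Fintype.piFinset T).filter fun b => ¬ IsNondegenerateSystem (sys a b)) * n₀
      ≤ #(pairs.biUnion H) * n₀ := Nat.mul_le_mul_right _ (card_le_card hcover)
    _ ≤ (∑ ij ∈ pairs, #(H ij)) * n₀ := Nat.mul_le_mul_right _ card_biUnion_le
    _ = ∑ ij ∈ pairs, #(H ij) * n₀ := Finset.sum_mul _ _ _
    _ ≤ ∑ ij ∈ pairs, ∏ l, #(T l) := sum_le_sum heach
    _ = #pairs * ∏ l, #(T l) := by rw [sum_const, smul_eq_mul]
    _ ≤ t * t * ∏ l, #(T l) := Nat.mul_le_mul_right _ hpc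

/-! ### Sandwiching the box-coset between block boxes -/

/-- A block box with `m_l M ≤ X_l + 1` sits inside the box `∏ [u_l, u_l + X_l]` (same cosets). -/
theorem coset_block_subset {q M : ℕ} (u c : Fin t → ℤ) (X m : Fin t → ℕ) (h : ∀ l, m l * M ≤ X l + 1) :
    (Fintype.piFinset fun l => Ico (u l) (u l + ((m l * M : ℕ) : ℤ))).filter
        (fun b => ∀ l, b l ≡ c l [ZMOD q]) ⊆
      (box u X).filter (fun b => ∀ l, b l ≡ c l [ZMOD q]) := by
  refine Finset.filter_subset_filter _ (Fintype.piFinset_subset _ _ fun l x hx => ?_)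
  rw [mem_Ico] at hx
  rw [mem_Icc]
  have h' : ((m l * M : ℕ) : ℤ) ≤ X l + 1 := by exact_mod_cast h l
  generalize ((m l * M : ℕ) : ℤ) = K at h' hx
  omega

/-- The box `∏ [u_l, u_l + X_l]` sits inside a block box with `X_l + 1 ≤ m_l M` (same cosets). -/
theorem subset_coset_block {q M : ℕ} (u c : Fin t → ℤ) (X m : Fin t → ℕ) (h : ∀ l, X l + 1 ≤ m l * M) :
    (box u X).filter (fun b => ∀ l, b l ≡ c l [ZMOD q]) ⊆
      (Fintype.piFinset fun l => Ico (u l) (u l + ((m l * M : ℕ) : ℤ))).filter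
        (fun b => ∀ l, b l ≡ c l [ZMOD q]) := by
  refine Finset.filter_subset_filter _ (Fintype.piFinset_subset _ _ fun l x hx => ?_)
  rw [mem_Icc] at hx
  rw [mem_Ico]
  have h' : (X l : ℤ) + 1 ≤ ((m l * M : ℕ) : ℤ) := by exact_mod_cast h l
  generalize ((m l * M : ℕ) : ℤ) = K at h' hx
  omega

end CosetMeanProof

open CosetMeanProof in
/-- **Registered auxiliary theorem** (infrastructure for `stub_cosetSingularMean`): EXACT COSET SUMS of the
`q`-coprime local products. For `q ≥ 1`, a finite set `S` of primes not dividing `q` with product `P`, and a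
block box `B = ∏_l [u_l, u_l + m_l P q)`: `∑_{b ∈ B, b ≡ c (q)} ∏_{p ∈ S} β_p(sys a b) = (∏_l m_l) P^t`
(Gallagher 1976 §2 along a progression, as in Goldston–Suriajaya 2021: the residues `b mod p`, `p ∤ q`,
equidistribute along the coset and the local factors average to exactly one). -/
theorem sum_coset_prod_localFactor_eq : ∀ {t q : ℕ}, 0 < q → ∀ (S : Finset ℕ), (∀ p ∈ S, p.Prime) → (∀ p ∈ S, ¬ p ∣ q) → ∀ (a u c : Fin t → ℤ) (m : Fin t → ℕ), ∑ b ∈ (Fintype.piFinset fun l => Finset.Ico (u l) (u l + ((m l * ((∏ p ∈ S, p) * q) : ℕ) : ℤ))).filter (fun b => ∀ l, Int.ModEq q (b l) (c l)), ∏ p ∈ S, localFactor (sys a b) p = (∏ l, (m l : ℝ)) * ((∏ p ∈ S, p : ℕ) : ℝ) ^ t :=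
  fun hq S hS hSq a u c m => sum_coset_prod_localFactor hq S hS hSq a u c m

end Summit.Parity.GeneralizedHardyLittlewood.Cruxes.RelativeDimOne.GallagherBackwardsSplit

end
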